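import Literature.Probability.LatticeModels.DobrushinShlosmanContraction
import Literature.Probability.LatticeModels.DobrushinMetricStates
import Mathlib.MeasureTheory.Function.FactorsThrough
import HarnessLib

/-!
# The Dobrushin–Shlosman window comparison: the window dusting estimate for a specification

The measure theory behind the abstract window comparison of `DobrushinShlosmanComparison.lean` /
`DobrushinShlosmanContraction.lean` (the window analogue of `DobrushinMetricStates.lean`), for a GENERAL specification `γ` on `V → S`
read through a cell map `cell : V → ι` (no torus geometry, no gauge theory; no definitions):

* `spec_apply_congr` — a specification kernel `γ_Λ(· | η)` depends on `η` only off `Λ`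
  (`𝓕_{Λᶜ}`-measurability, Mathlib `Measurable.factorsThrough`);
* `abs_sub_le_sum_cells` — the cell interpolation bound `|F σ - F τ| ≤ R Σ_x δ x` for cell-Lipschitz bounds
  `δ` with respect to a cell weight `w ≤ R`;
* `lip_windowAvg` — the WINDOW DUSTING ESTIMATE (the multi-site analogue of the tree's
  `DobrushinMetric.isLipBound_siteAvg`, Föllmer 1988 Ch. I Lemma (2.5)): for a window with site set `Λ` and
  cell set `W` (`v ∈ Λ ↔ cell v ∈ W`), a weight local in its cell, and the one-boundary-cell Kantorovich
  CONTRACTION hypothesis of Dobrushin–Shlosman (stated dually on window-local cell-Lipschitz test functions,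
  coefficients `kc y x`), for `ω = η` off the cell `y`: `γ_Λ F(ω) = γ_Λ F(η)` if `y ∈ W`, and otherwise
  `|γ_Λ F(ω) - γ_Λ F(η)| ≤ (δ y + Σ_{x ∈ W} kc y x δ x) · w y ω η` — split as
  `∫ [F(σ_Λ ω) - F(σ_Λ η)] dγ_Λ(·|ω)` (properness, Lipschitz bound of `F` at `y`, locality of `w`) plus
  `∫ ψ dγ_Λ(·|ω) - ∫ ψ dγ_Λ(·|η)` for the window-local `ψ = F(·_Λ η_{Λᶜ})` (contraction).

References: Dobrushin–Shlosman 1985; Föllmer 1988 Ch. I §2; Georgii 2011 Def. 1.23.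
-/

noncomputable section

open MeasureTheory ProbabilityTheory Finset Function

namespace Literature.Probability.LatticeModels.DobrushinShlosman

variable {ι V S : Type*} [MeasurableSpace S]

/-! ### Generalities on specification kernels -/

/-- **A specification kernel depends on the boundary condition only off its volume**: if `ω = η` off `Λ`
then `γ_Λ(· | ω) = γ_Λ(· | η)` (`𝓕_{Λᶜ}`-measurability of `η ↦ γ_Λ(A | η)`, Georgii 2011 Def. 1.23
(ii), through Mathlib `Measurable.factorsThrough`). [cite: Georgii2011, Def. 1.23] -/
theorem spec_apply_congr {γ : Specification V S} (hγ : IsSpecification γ) (Λ : Finset V) {ω η : V → S}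
    (h : ∀ v ∉ Λ, ω v = η v) : γ Λ ω = γ Λ η := by
  refine Measure.ext fun A hA => ?_
  -- adapted from `Literature.Probability.LatticeModels.dependsOn_of_measurable_cylinderEvents`
  have hle : cylinderEvents (X := fun _ : V => S) ((↑Λ : Set V)ᶜ) ≤
      MeasurableSpace.comap (Set.restrict ((↑Λ : Set V)ᶜ)) MeasurableSpace.pi := by
    refine iSup₂_le fun i hi => ?_
    have : (fun σ : V → S => σ i) = (fun g : ((↑Λ : Set V)ᶜ : Set V) → S => g ⟨i, hi⟩) ∘
        Set.restrict ((↑Λ : Set V)ᶜ) := rfl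
    rw [this, ← MeasurableSpace.comap_comp]
    exact MeasurableSpace.comap_mono (measurable_pi_apply _).comap_le
  have hft := ((hγ.measurable Λ A hA).mono hle le_rfl).factorsThrough
  exact hft (funext fun v => h v fun hv => v.2 (Finset.mem_coe.2 hv))

/-- The window average `η ↦ ∫ F dγ_Λ(· | η)` of a measurable `F` is measurable. [folklore] -/
theorem measurable_windowAvg' {γ : Specification V S} (hγ : IsSpecification γ) (Λ : Finset V)
    {F : (V → S) → ℝ} (hF : Measurable F) : Measurable fun η => ∫ σ, F σ ∂(γ Λ η) := by
  -- adapted from `DobrushinMetric.measurable_siteAvg`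
  let κ : Kernel (V → S) (V → S) := ⟨γ Λ, hγ.measurable_fun Λ⟩
  exact (hF.stronglyMeasurable.integral_kernel (κ := κ)).measurable

/-- `|∫ F dγ_Λ(· | η)| ≤ B` if `|F| ≤ B`. [folklore] -/
theorem abs_windowAvg_le' {γ : Specification V S} (hγ : IsSpecification γ) (Λ : Finset V)
    {F : (V → S) → ℝ} {B : ℝ} (hB : ∀ σ, |F σ| ≤ B) (η : V → S) : |∫ σ, F σ ∂(γ Λ η)| ≤ B := by
  haveI := hγ.isProbability Λ η
  have h := norm_integral_le_of_norm_le_const (μ := γ Λ η) (f := F) (C := B)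
    (ae_of_all _ fun σ => by rw [Real.norm_eq_abs]; exact hB σ)
  simpa using h

/-- **Properness, functional form**: `∫ F dγ_Λ(· | ω) = ∫ F(σ_Λ ω_{Λᶜ}) dγ_Λ(dσ | ω)`.
[cite: Georgii2011, Def. 1.23] -/
theorem windowAvg_eq_integral_piecewise [DecidableEq V] {γ : Specification V S} (hγ : IsSpecification γ)
    (Λ : Finset V) (F : (V → S) → ℝ) (ω : V → S) :
    ∫ σ, F σ ∂(γ Λ ω) = ∫ σ, F (Λ.piecewise σ ω) ∂(γ Λ ω) := by
  refine integral_congr_ae ?_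
  filter_upwards [hγ.proper Λ ω] with σ hσ
  congr 1
  funext v
  by_cases hv : v ∈ Λ
  · rw [Finset.piecewise_eq_of_mem _ _ _ hv]
  · rw [Finset.piecewise_eq_of_notMem _ _ _ hv, hσ v hv]

/-- `σ ↦ σ_Λ ω_{Λᶜ}` is measurable. [folklore] -/
theorem measurable_piecewise_conf [DecidableEq V] (Λ : Finset V) (ω : V → S) :
    Measurable fun σ : V → S => Λ.piecewise σ ω := by
  refine measurable_pi_lambda _ fun v => ?_
  by_cases hv : v ∈ Λ
  · simp only [Finset.piecewise_eq_of_mem _ _ _ hv]; exact measurable_pi_apply v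
  · simp only [Finset.piecewise_eq_of_notMem _ _ _ hv]; exact measurable_const

/-! ### Cell-Lipschitz bounds -/

omit [MeasurableSpace S] in
/-- **Cell interpolation bound** (Föllmer 1988 Ch. I Remark (2.17), cells instead of sites): if
`|F σ - F τ| ≤ δ x · w x σ τ` whenever `σ = τ` off the cell `x`, with `δ ≥ 0` and `w ≤ R`, then
`|F σ - F τ| ≤ R Σ_x δ x` — change the cells of `σ` into those of `τ` one at a time.
[cite: Follmer1988, Ch. I Remark (2.17)] -/
theorem abs_sub_le_sum_cells [Fintype ι] [DecidableEq ι] {cell : V → ι}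
    {w : ι → (V → S) → (V → S) → ℝ} {R : ℝ} (hwR : ∀ c σ τ, w c σ τ ≤ R) {F : (V → S) → ℝ}
    {δ : ι → ℝ} (hδ0 : ∀ x, 0 ≤ δ x)
    (hδ : ∀ (x : ι) (σ τ : V → S), (∀ v, cell v ≠ x → σ v = τ v) → |F σ - F τ| ≤ δ x * w x σ τ)
    (σ τ : V → S) : |F σ - F τ| ≤ R * ∑ x, δ x := by
  -- adapted from `DobrushinMetric.abs_sub_le_sum_of_dependsOn`
  suffices h : ∀ s : Finset ι,
      |F σ - F (fun v => if cell v ∈ s then τ v else σ v)| ≤ R * ∑ x ∈ s, δ x by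
    simpa using h Finset.univ
  intro s
  induction s using Finset.induction_on with
  | empty => simp
  | insert x s hx ih =>
    rw [Finset.sum_insert hx, mul_add]
    have hstep : |F (fun v => if cell v ∈ s then τ v else σ v) -
        F (fun v => if cell v ∈ insert x s then τ v else σ v)| ≤ R * δ x := by
      have h := hδ x (fun v => if cell v ∈ s then τ v else σ v)
        (fun v => if cell v ∈ insert x s then τ v else σ v) fun v hv => by
          have e : (cell v ∈ insert x s) ↔ (cell v ∈ s) := by simp [Finset.mem_insert, hv]
          simp only [e]
      refine h.trans ?_
      rw [mul_comm]
      exact mul_le_mul_of_nonneg_right (hwR _ _ _) (hδ0 x)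
    calc |F σ - F (fun v => if cell v ∈ insert x s then τ v else σ v)|
        ≤ |F σ - F (fun v => if cell v ∈ s then τ v else σ v)| +
            |F (fun v => if cell v ∈ s then τ v else σ v) -
              F (fun v => if cell v ∈ insert x s then τ v else σ v)| := abs_sub_le _ _ _
      _ ≤ R * ∑ x ∈ s, δ x + R * δ x := add_le_add ih hstep
      _ = R * δ x + R * ∑ x ∈ s, δ x := add_comm _ _

/-! ### The window dusting estimate -/

/-- **The window dusting estimate** (Föllmer 1988 Ch. I, proof of Lemma (2.5), one WINDOW instead of one
site; Dobrushin–Shlosman 1985): for a window with site set `Λ` and cell set `W`, a cell weight `w` local in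
its cell, the contraction hypothesis `hcontract` of the window kernel under a change of the boundary
condition on one cell outside the window, a bounded measurable `F` with cell-Lipschitz bounds `δ`, and
boundary conditions `ω = η` off the cell `y`: `γ_Λ F (ω) = γ_Λ F (η)` if `y ∈ W`, and otherwise
`|γ_Λ F (ω) - γ_Λ F (η)| ≤ (δ y + Σ_{x ∈ W} kc y x δ x) · w y ω η`. [cite: Follmer1988, Ch. I Lemma (2.5)] -/
theorem lip_windowAvg [DecidableEq ι] [DecidableEq V] {γ : Specification V S} (hγ : IsSpecification γ)
    {cell : V → ι}
    {w : ι → (V → S) → (V → S) → ℝ}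
    (hwloc : ∀ (c : ι) (σ σ' τ τ' : V → S), (∀ v, cell v = c → σ v = σ' v) →
      (∀ v, cell v = c → τ v = τ' v) → w c σ τ = w c σ' τ')
    {Λ : Finset V} {W : Finset ι} (hΛ : ∀ v, v ∈ Λ ↔ cell v ∈ W) {kc : ι → ι → ℝ}
    (hcontract : ∀ y, y ∉ W → ∀ (ω η : V → S), (∀ v, cell v ≠ y → ω v = η v) →
      ∀ (f : (V → S) → ℝ) (δ : ι → ℝ), Measurable f → (∃ B, ∀ σ, |f σ| ≤ B) →
        DependsOn f {v | cell v ∈ W} → (∀ x, 0 ≤ δ x) →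
        (∀ (x : ι) (σ τ : V → S), (∀ v, cell v ≠ x → σ v = τ v) → |f σ - f τ| ≤ δ x * w x σ τ) →
          |∫ σ, f σ ∂(γ Λ ω) - ∫ σ, f σ ∂(γ Λ η)| ≤ (∑ x ∈ W, kc y x * δ x) * w y ω η)
    {F : (V → S) → ℝ} (hFm : Measurable F) {B : ℝ} (hB : ∀ σ, |F σ| ≤ B) {δ : ι → ℝ}
    (hδ0 : ∀ x, 0 ≤ δ x)
    (hδ : ∀ (x : ι) (σ τ : V → S), (∀ v, cell v ≠ x → σ v = τ v) → |F σ - F τ| ≤ δ x * w x σ τ)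
    (y : ι) (ω η : V → S) (hωη : ∀ v, cell v ≠ y → ω v = η v) :
    |∫ σ, F σ ∂(γ Λ ω) - ∫ σ, F σ ∂(γ Λ η)| ≤
      (if y ∈ W then 0 else δ y + ∑ x ∈ W, kc y x * δ x) * w y ω η := by
  by_cases hy : y ∈ W
  · -- a window cell: the kernel does not see the difference
    rw [if_pos hy, zero_mul]
    have hΛωη : ∀ v ∉ Λ, ω v = η v := fun v hv => hωη v fun hcv => hv ((hΛ v).2 (hcv ▸ hy))
    rw [spec_apply_congr hγ Λ hΛωη, sub_self, abs_zero]
  rw [if_neg hy]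
  haveI := hγ.isProbability Λ ω
  haveI := hγ.isProbability Λ η
  -- sites of the cell `y` lie outside the window
  have hyΛ : ∀ v, cell v = y → v ∉ Λ := fun v hv hvΛ => hy (hv ▸ (hΛ v).1 hvΛ)
  -- the window-local transport `ψ = F(·_Λ η_{Λᶜ})`
  set ψ : (V → S) → ℝ := fun σ => F (Λ.piecewise σ η) with hψ
  have hψm : Measurable ψ := hFm.comp (measurable_piecewise_conf Λ η)
  have hψB : ∀ σ, |ψ σ| ≤ B := fun σ => hB _
  have hψdep : DependsOn ψ {v | cell v ∈ W} := by
    intro σ σ' hσ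
    simp only [hψ]
    congr 1
    funext v
    by_cases hv : v ∈ Λ
    · rw [Finset.piecewise_eq_of_mem _ _ _ hv, Finset.piecewise_eq_of_mem _ _ _ hv]
      exact hσ v ((hΛ v).1 hv)
    · rw [Finset.piecewise_eq_of_notMem _ _ _ hv, Finset.piecewise_eq_of_notMem _ _ _ hv]
  have hψlip : ∀ (x : ι) (σ τ : V → S), (∀ v, cell v ≠ x → σ v = τ v) →
      |ψ σ - ψ τ| ≤ (if x ∈ W then δ x else 0) * w x σ τ := by
    intro x σ τ hστ
    by_cases hx : x ∈ W
    · rw [if_pos hx]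
      have h1 : |ψ σ - ψ τ| ≤ δ x * w x (Λ.piecewise σ η) (Λ.piecewise τ η) :=
        hδ x _ _ fun v hv => by
          by_cases hvΛ : v ∈ Λ
          · rw [Finset.piecewise_eq_of_mem _ _ _ hvΛ, Finset.piecewise_eq_of_mem _ _ _ hvΛ]
            exact hστ v hv
          · rw [Finset.piecewise_eq_of_notMem _ _ _ hvΛ, Finset.piecewise_eq_of_notMem _ _ _ hvΛ]
      have h2 : w x (Λ.piecewise σ η) (Λ.piecewise τ η) = w x σ τ :=
        hwloc x _ _ _ _ (fun v hv => Finset.piecewise_eq_of_mem _ _ _ ((hΛ v).2 (hv ▸ hx)))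
          (fun v hv => Finset.piecewise_eq_of_mem _ _ _ ((hΛ v).2 (hv ▸ hx)))
      rwa [h2] at h1
    · rw [if_neg hx, zero_mul]
      have : Λ.piecewise σ η = Λ.piecewise τ η := by
        funext v
        by_cases hvΛ : v ∈ Λ
        · rw [Finset.piecewise_eq_of_mem _ _ _ hvΛ, Finset.piecewise_eq_of_mem _ _ _ hvΛ]
          exact hστ v fun hvx => hx (hvx ▸ (hΛ v).1 hvΛ)
        · rw [Finset.piecewise_eq_of_notMem _ _ _ hvΛ, Finset.piecewise_eq_of_notMem _ _ _ hvΛ]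
      simp only [hψ, this, sub_self, abs_zero, le_refl]
  -- second term: the contraction hypothesis applied to `ψ`
  have h2 : |∫ σ, ψ σ ∂(γ Λ ω) - ∫ σ, ψ σ ∂(γ Λ η)| ≤ (∑ x ∈ W, kc y x * δ x) * w y ω η := by
    have h := hcontract y hy ω η hωη ψ (fun x => if x ∈ W then δ x else 0) hψm ⟨B, hψB⟩
      hψdep (fun x => by split_ifs; exacts [hδ0 x, le_rfl]) hψlip
    have hsum : ∑ x ∈ W, kc y x * (if x ∈ W then δ x else 0) = ∑ x ∈ W, kc y x * δ x :=
      Finset.sum_congr rfl fun x hx => by rw [if_pos hx]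
    rwa [hsum] at h
  -- first term: transport of the boundary condition inside `F`
  have hint : ∀ τ : V → S, Integrable (fun σ => F (Λ.piecewise σ τ)) (γ Λ ω) := fun τ =>
    DobrushinMetric.integrable_of_abs_le' (hFm.comp (measurable_piecewise_conf Λ τ)) fun σ => hB _
  have h1 : |∫ σ, F (Λ.piecewise σ ω) ∂(γ Λ ω) - ∫ σ, ψ σ ∂(γ Λ ω)| ≤ δ y * w y ω η := by
    rw [← integral_sub (hint ω) (hint η)]
    have hpt : ∀ σ, |F (Λ.piecewise σ ω) - F (Λ.piecewise σ η)| ≤ δ y * w y ω η := fun σ => by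
      have h := hδ y (Λ.piecewise σ ω) (Λ.piecewise σ η) fun v hv => by
        by_cases hvΛ : v ∈ Λ
        · rw [Finset.piecewise_eq_of_mem _ _ _ hvΛ, Finset.piecewise_eq_of_mem _ _ _ hvΛ]
        · rw [Finset.piecewise_eq_of_notMem _ _ _ hvΛ, Finset.piecewise_eq_of_notMem _ _ _ hvΛ]
          exact hωη v hv
      have hw : w y (Λ.piecewise σ ω) (Λ.piecewise σ η) = w y ω η :=
        hwloc y _ _ _ _ (fun v hv => Finset.piecewise_eq_of_notMem _ _ _ (hyΛ v hv))
          (fun v hv => Finset.piecewise_eq_of_notMem _ _ _ (hyΛ v hv))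
      rwa [hw] at h
    have h := norm_integral_le_of_norm_le_const (μ := γ Λ ω)
      (f := fun σ => F (Λ.piecewise σ ω) - F (Λ.piecewise σ η)) (C := δ y * w y ω η)
      (ae_of_all _ fun σ => by rw [Real.norm_eq_abs]; exact hpt σ)
    simpa using h
  rw [windowAvg_eq_integral_piecewise hγ Λ F ω, windowAvg_eq_integral_piecewise hγ Λ F η]
  calc |∫ σ, F (Λ.piecewise σ ω) ∂(γ Λ ω) - ∫ σ, F (Λ.piecewise σ η) ∂(γ Λ η)|
      ≤ |∫ σ, F (Λ.piecewise σ ω) ∂(γ Λ ω) - ∫ σ, ψ σ ∂(γ Λ ω)| +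
          |∫ σ, ψ σ ∂(γ Λ ω) - ∫ σ, ψ σ ∂(γ Λ η)| := abs_sub_le _ _ _
    _ ≤ δ y * w y ω η + (∑ x ∈ W, kc y x * δ x) * w y ω η := add_le_add h1 h2
    _ = (δ y + ∑ x ∈ W, kc y x * δ x) * w y ω η := by ring

end Literature.Probability.LatticeModels.DobrushinShlosman

end
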